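import Summits.BirchSwinnertonDyer.BirchSwinnertonDyer.Theorems.SignedLowerHalvesSprungLowerDivisibilityAtThreeCokerBoundByMassContra
import Summits.BirchSwinnertonDyer.BirchSwinnertonDyer.Theorems.SignedLowerHalvesSprungLowerDivisibilityAtThreeCokerBoundByMassPoitouTate
import Literature.NumberTheory.EllipticCurves.Kato2004.IwasawaCohomologyExistsProofs
import HarnessLib

/-!
# Crux `SprungLowerDivisibilityAtThree` (item stmt-BirchSwinnertonDyer-19875; x8 children 22569 / 22901 / 22570 / 23112 / 23401),
# line `chromatic-common-zeros`: «F-α♮ BY MASS», part 6 — the CONTRA (C′) F-α♮ telescope from the named printed facts (w3 g9's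
# Poitou–Tate fact fed into this seat's Contra chain), and both telescopes with `nonempty_iwasawaH1Data` DISCHARGED (four facts)

Cell `bsd-ssimc` (host), width seat `cruxlead-stmt-BirchSwinnertonDyer-19875-w2` (gen 9) under the 19875 LEAD; `--supports`
stmt-BirchSwinnertonDyer-22569 `--as helper`; theorems only; closes NO item. Composition ONLY (w3 g9's hand-off 21:02Z «the Contra
telescope is yours — feed it `massCotorsion_of_poitouTate hPT h124 hI`»): `…CokerBoundByMassPoitouTate` (w3 g9, p667731:
`massCotorsion_of_poitouTate`, `cokerBoundIotaOffT_of_poitouTate` from the typed fact `Sprung2012.thm714seq_sharpFlat_poitouTate_functionalModel`,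
p666901) ∘ `…CokerBoundByMassContra` (this seat, p667265: `cokerBoundIotaOffT_contra_of_cotorsion_of_matar`); the construction fact
`Kato2004.nonempty_iwasawaH1Data` is a tree THEOREM (`Kato2004.nonempty_iwasawaH1Data_holds`), so it is discharged here. HONEST FRAMING:
CONDITIONAL on the four named printed facts `Sprung2012.thm714seq_sharpFlat_poitouTate_functionalModel` (Poitou–Tate in the functional model),
`Kato2004.thm12_4`, `matar2020_thm11_selmerDualTorsion_pseudoIso_fineSelmerDual`, `Kato2004_fineSelmerDual_isTorsion`; F-α♮ is thereby
SETTLED BY CITATION only (typed ≠ proved); K_spor, S4b-cyc, R♮, K1, leaf X8, the C′ twin route and BSD are NOT proved by anything here.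

* `cokerBoundIotaOffT_of_poitouTate'` — the REGISTERED γ-keyed stub `IotaDoor.stub_cokerBoundIotaOffT` (22569 / 22901 / 22570 / 23112 /
  23401) from FOUR named facts (w3 g9's five-fact theorem with `hI` discharged).
* `cokerBoundIotaOffT_contra_of_poitouTate` / `…'` — the CONTRA telescope (packages `SharpFlatColemanKatoDataContra`, fine datum of key
  `γ⁻¹`) from the same five / four facts — the F-α♮ input of the LEAD's Contra ι-door (PrintX8VSC / C′).

References: [Kobayashi2003] Prop. 7.1, Thm. 7.3; [Kato2004Asterisque] (12.2.1), Thm. 12.4, (17.13.1); [Sprung2012] Thm. 7.14 (3), §7.1, Def. 7.9–7.13;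
[Matar2020] Thm. 1.1; [Wingberg1989] Cor. 2.5; [LeiSujatha2021] (SES-KP), (PT); tree: `…CokerBoundByMass{,Skeleton,Matar,Keying,Contra,PoitouTate}`,
`Sprung2012/SharpFlatPoitouTateFunctionalModel` (p666901), `Kato2004/IwasawaCohomologyExistsProofs`.
-/

set_option linter.dupNamespace false
set_option autoImplicit false

noncomputable section

open scoped Classical NumberField MatrixGroups ModularForm

open NumberField IsDedekindDomain CongruenceSubgroup WeierstrassCurve Field
  Literature.NumberTheory.EllipticCurves Literature.NumberTheory.EllipticCurves.ModularForms
  Literature.NumberTheory.EllipticCurves.ZpExtension Literature.NumberTheory.EllipticCurves.Sprung2017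
  Literature.NumberTheory.EllipticCurves.Sprung2012 Literature.NumberTheory.EllipticCurves.Rank1Residual
  Literature.NumberTheory.EllipticCurves.IwasawaAlgebra Literature.NumberTheory.EllipticCurves.Kato2004
  Literature.NumberTheory.EllipticCurves.Module

namespace Summit.BirchSwinnertonDyer.BirchSwinnertonDyer.Theorems.ChromaticCommonZeros

/-- **F-α♮ — the registered stub `IotaDoor.stub_cokerBoundIotaOffT`, SIGNATURE VERBATIM, from FOUR named printed facts** (w3 g9's
`cokerBoundIotaOffT_of_poitouTate` with the construction fact `Kato2004.nonempty_iwasawaH1Data` discharged by the tree theorem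
`Kato2004.nonempty_iwasawaH1Data_holds`): Poitou–Tate in the functional model, Kato Thm. 12.4, Matar 2020 Thm. 1.1, Kato Thm. 12.4 (1) for
the fine dual. [cite: Kobayashi2003, Prop. 7.1 and Thm. 7.3 (pp. 12–13)] [cite: Kato2004Asterisque, Thm. 12.4 (p. 221), (17.13.1) (p. 279)]
[cite: Matar2020, Thm. 1.1] [cite: Sprung2012, Thm. 7.14 (3) (p. 1504), Prop. 7.19 (p. 1505)] -/
theorem cokerBoundIotaOffT_of_poitouTate' (hPT : thm714seq_sharpFlat_poitouTate_functionalModel)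
    (h124 : Kato2004.thm12_4) (hMatar : matar2020_thm11_selmerDualTorsion_pseudoIso_fineSelmerDual)
    (hfine : Kato2004_fineSelmerDual_isTorsion) :
    ∀ (W : WeierstrassCurve ℚ) [W.IsElliptic] [W.IsGloballyMinimal] (p : ℕ) [Fact p.Prime]
      [ContinuousSMul ℤ_[p] (W.tateModule p)] [Module.Free ℤ_[p] (W.tateModule p)]
      [Module.Finite ℤ_[p] (W.tateModule p)],
      ClassX8 W p → ∀ (κ : ZpExtension ℚ p) (γ : Field.absoluteGaloisGroup ℚ),
      κ.IsCyclotomic → κ.IsTopGenerator γ → IsCyclotomicVariable p γ →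
    ∀ (v : HeightOneSpectrum (𝓞 ℚ)), (p : 𝓞 ℚ) ∈ v.asIdeal →
    ∀ (g : Field.absoluteGaloisGroup (v.adicCompletion ℚ)),
      κ.IsTopGenerator (resGalOfEmb (closureEmb (K := ℚ) (v.adicCompletion ℚ)) g) →
    ∀ (cneg : localPoints W (v.adicCompletion ℚ)) (c : ℕ → localPoints W (v.adicCompletion ℚ)),
      IsHondaSystem κ (closureEmb (K := ℚ) (v.adicCompletion ℚ)) W (W.frobeniusTrace p) g cneg c →
    ∀ (N : ℕ) (_ : NeZero N) (f : CuspForm (Gamma0 N) 2) (ϖ : ℚ) (Lsharp Lflat : IwasawaAlgebra p),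
      IsNewformOf W f → (ϖ : ℝ) * W.realPeriodRat = plusPeriod f →
      IsSprungPair f p (W.frobeniusTrace p) Lsharp Lflat →
    ∀ (I : Kato2004.IwasawaH1Data W p κ γ)
      (Cs : SharpFlatColemanKatoData W p f ϖ κ γ (closureEmb (K := ℚ) (v.adicCompletion ℚ))
        (W.frobeniusTrace p) g c Chroma.sharp I)
      (Cf : SharpFlatColemanKatoData W p f ϖ κ γ (closureEmb (K := ℚ) (v.adicCompletion ℚ))
        (W.frobeniusTrace p) g c Chroma.flat I),
      Cs.Z = Cf.Z →
    ∀ (Y : W.FineSelmerDualData κ γ) (𝔭 : PrimeSpectrum (IwasawaAlgebra p)), 𝔭.asIdeal.height = 1 →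
      (p : IwasawaAlgebra p) ∉ 𝔭.asIdeal → (PowerSeries.X : IwasawaAlgebra p) ∉ 𝔭.asIdeal →
      (∀ (col' : Chroma) (G' : IwasawaAlgebra p),
        iwasawaToPowerSeries p G' =
          PowerSeries.C (ϖ : ℚ_[p]) * iwasawaToPowerSeries p (chromaticL col' Lsharp Lflat) →
        G' ∈ 𝔭.asIdeal) →
      min (Module.lengthAt (IwasawaAlgebra p) (IwasawaAlgebra p ⧸ LinearMap.range Cs.colMap) 𝔭)
          (Module.lengthAt (IwasawaAlgebra p) (IwasawaAlgebra p ⧸ LinearMap.range Cf.colMap) 𝔭) ≤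
        Module.lengthAt (IwasawaAlgebra p) Y.X (PrimeSpectrum.comap (invol p).toRingHom 𝔭)  :=
  cokerBoundIotaOffT_of_poitouTate hPT h124 Kato2004.nonempty_iwasawaH1Data_holds hMatar hfine

/-- **THE CONTRA (C′) F-α♮ TELESCOPE from five named printed facts** (packages `SharpFlatColemanKatoDataContra`, fine datum of key `γ⁻¹`;
same binders as the registered stub otherwise): `cokerBoundIotaOffT_contra_of_cotorsion_of_matar ∘ massCotorsion_of_poitouTate` — the
F-α♮ hypothesis of a Contra `stubs_offT_of_iotaDoor`. [cite: Kobayashi2003, Prop. 7.1 and Thm. 7.3 (pp. 12–13)]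
[cite: Kato2004Asterisque, (12.2.1) (p. 220), Thm. 12.4 (p. 221), (17.13.1) (p. 279)] [cite: Matar2020, Thm. 1.1] [cite: Wingberg1989, Cor. 2.5]
[cite: Sprung2012, Thm. 7.14 (3) (p. 1504), Prop. 7.19 (p. 1505)] -/
theorem cokerBoundIotaOffT_contra_of_poitouTate (hPT : thm714seq_sharpFlat_poitouTate_functionalModel)
    (h124 : Kato2004.thm12_4) (hI : Kato2004.nonempty_iwasawaH1Data)
    (hMatar : matar2020_thm11_selmerDualTorsion_pseudoIso_fineSelmerDual) (hfine : Kato2004_fineSelmerDual_isTorsion) :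
    ∀ (W : WeierstrassCurve ℚ) [W.IsElliptic] [W.IsGloballyMinimal] (p : ℕ) [Fact p.Prime]
      [ContinuousSMul ℤ_[p] (W.tateModule p)] [Module.Free ℤ_[p] (W.tateModule p)]
      [Module.Finite ℤ_[p] (W.tateModule p)],
      ClassX8 W p → ∀ (κ : ZpExtension ℚ p) (γ : Field.absoluteGaloisGroup ℚ),
      κ.IsCyclotomic → κ.IsTopGenerator γ → IsCyclotomicVariable p γ →
    ∀ (v : HeightOneSpectrum (𝓞 ℚ)), (p : 𝓞 ℚ) ∈ v.asIdeal →
    ∀ (g : Field.absoluteGaloisGroup (v.adicCompletion ℚ)),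
      κ.IsTopGenerator (resGalOfEmb (closureEmb (K := ℚ) (v.adicCompletion ℚ)) g) →
    ∀ (cneg : localPoints W (v.adicCompletion ℚ)) (c : ℕ → localPoints W (v.adicCompletion ℚ)),
      IsHondaSystem κ (closureEmb (K := ℚ) (v.adicCompletion ℚ)) W (W.frobeniusTrace p) g cneg c →
    ∀ (N : ℕ) (_ : NeZero N) (f : CuspForm (Gamma0 N) 2) (ϖ : ℚ) (Lsharp Lflat : IwasawaAlgebra p),
      IsNewformOf W f → (ϖ : ℝ) * W.realPeriodRat = plusPeriod f →
      IsSprungPair f p (W.frobeniusTrace p) Lsharp Lflat →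
    ∀ (I : Kato2004.IwasawaH1Data W p κ γ)
      (Cs : SharpFlatColemanKatoDataContra W p f ϖ κ γ (closureEmb (K := ℚ) (v.adicCompletion ℚ))
        (W.frobeniusTrace p) g c Chroma.sharp I)
      (Cf : SharpFlatColemanKatoDataContra W p f ϖ κ γ (closureEmb (K := ℚ) (v.adicCompletion ℚ))
        (W.frobeniusTrace p) g c Chroma.flat I),
      Cs.Z = Cf.Z →
    ∀ (Y : W.FineSelmerDualData κ γ⁻¹) (𝔭 : PrimeSpectrum (IwasawaAlgebra p)), 𝔭.asIdeal.height = 1 →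
      (p : IwasawaAlgebra p) ∉ 𝔭.asIdeal → (PowerSeries.X : IwasawaAlgebra p) ∉ 𝔭.asIdeal →
      (∀ (col' : Chroma) (G' : IwasawaAlgebra p),
        iwasawaToPowerSeries p G' =
          PowerSeries.C (ϖ : ℚ_[p]) * iwasawaToPowerSeries p (chromaticL col' Lsharp Lflat) →
        G' ∈ 𝔭.asIdeal) →
      min (Module.lengthAt (IwasawaAlgebra p) (IwasawaAlgebra p ⧸ LinearMap.range Cs.colMap) 𝔭)
          (Module.lengthAt (IwasawaAlgebra p) (IwasawaAlgebra p ⧸ LinearMap.range Cf.colMap) 𝔭) ≤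
        Module.lengthAt (IwasawaAlgebra p) Y.X (PrimeSpectrum.comap (invol p).toRingHom 𝔭)  :=
  cokerBoundIotaOffT_contra_of_cotorsion_of_matar (massCotorsion_of_poitouTate hPT h124 hI) hMatar hfine

/-- **The Contra F-α♮ telescope from FOUR named printed facts** (`hI` discharged by `Kato2004.nonempty_iwasawaH1Data_holds`).
[cite: Kobayashi2003, Prop. 7.1 and Thm. 7.3 (pp. 12–13)] [cite: Kato2004Asterisque, Thm. 12.4 (p. 221), (17.13.1) (p. 279)]
[cite: Matar2020, Thm. 1.1] [cite: Sprung2012, Thm. 7.14 (3) (p. 1504)] -/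
theorem cokerBoundIotaOffT_contra_of_poitouTate' (hPT : thm714seq_sharpFlat_poitouTate_functionalModel)
    (h124 : Kato2004.thm12_4) (hMatar : matar2020_thm11_selmerDualTorsion_pseudoIso_fineSelmerDual)
    (hfine : Kato2004_fineSelmerDual_isTorsion) :
    ∀ (W : WeierstrassCurve ℚ) [W.IsElliptic] [W.IsGloballyMinimal] (p : ℕ) [Fact p.Prime]
      [ContinuousSMul ℤ_[p] (W.tateModule p)] [Module.Free ℤ_[p] (W.tateModule p)]
      [Module.Finite ℤ_[p] (W.tateModule p)],
      ClassX8 W p → ∀ (κ : ZpExtension ℚ p) (γ : Field.absoluteGaloisGroup ℚ),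
      κ.IsCyclotomic → κ.IsTopGenerator γ → IsCyclotomicVariable p γ →
    ∀ (v : HeightOneSpectrum (𝓞 ℚ)), (p : 𝓞 ℚ) ∈ v.asIdeal →
    ∀ (g : Field.absoluteGaloisGroup (v.adicCompletion ℚ)),
      κ.IsTopGenerator (resGalOfEmb (closureEmb (K := ℚ) (v.adicCompletion ℚ)) g) →
    ∀ (cneg : localPoints W (v.adicCompletion ℚ)) (c : ℕ → localPoints W (v.adicCompletion ℚ)),
      IsHondaSystem κ (closureEmb (K := ℚ) (v.adicCompletion ℚ)) W (W.frobeniusTrace p) g cneg c →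
    ∀ (N : ℕ) (_ : NeZero N) (f : CuspForm (Gamma0 N) 2) (ϖ : ℚ) (Lsharp Lflat : IwasawaAlgebra p),
      IsNewformOf W f → (ϖ : ℝ) * W.realPeriodRat = plusPeriod f →
      IsSprungPair f p (W.frobeniusTrace p) Lsharp Lflat →
    ∀ (I : Kato2004.IwasawaH1Data W p κ γ)
      (Cs : SharpFlatColemanKatoDataContra W p f ϖ κ γ (closureEmb (K := ℚ) (v.adicCompletion ℚ))
        (W.frobeniusTrace p) g c Chroma.sharp I)
      (Cf : SharpFlatColemanKatoDataContra W p f ϖ κ γ (closureEmb (K := ℚ) (v.adicCompletion ℚ))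
        (W.frobeniusTrace p) g c Chroma.flat I),
      Cs.Z = Cf.Z →
    ∀ (Y : W.FineSelmerDualData κ γ⁻¹) (𝔭 : PrimeSpectrum (IwasawaAlgebra p)), 𝔭.asIdeal.height = 1 →
      (p : IwasawaAlgebra p) ∉ 𝔭.asIdeal → (PowerSeries.X : IwasawaAlgebra p) ∉ 𝔭.asIdeal →
      (∀ (col' : Chroma) (G' : IwasawaAlgebra p),
        iwasawaToPowerSeries p G' =
          PowerSeries.C (ϖ : ℚ_[p]) * iwasawaToPowerSeries p (chromaticL col' Lsharp Lflat) →
        G' ∈ 𝔭.asIdeal) →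
      min (Module.lengthAt (IwasawaAlgebra p) (IwasawaAlgebra p ⧸ LinearMap.range Cs.colMap) 𝔭)
          (Module.lengthAt (IwasawaAlgebra p) (IwasawaAlgebra p ⧸ LinearMap.range Cf.colMap) 𝔭) ≤
        Module.lengthAt (IwasawaAlgebra p) Y.X (PrimeSpectrum.comap (invol p).toRingHom 𝔭)  :=
  cokerBoundIotaOffT_contra_of_poitouTate hPT h124 Kato2004.nonempty_iwasawaH1Data_holds hMatar hfine

end Summit.BirchSwinnertonDyer.BirchSwinnertonDyer.Theorems.ChromaticCommonZeros

end
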